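import Summits.AtomisticToContinuum.Crystallization.Theorems.PalmUnimodularRigidityLayeredLawsSelectHcpChartCubeFrames

/-!
# Crux `LayeredLawsSelectHcp` (stmt-AtomisticToContinuum-9226), line `mtp-prestress-split-ergodic-frame`:
# Kuhn label coordinates of the ideal hcp (vocabulary of the threshold interpolation `stub_chartInterpolation`, T4)

The registered stub `stub_chartInterpolation` (lead c4) extends a tube chart `X : ℤ³ → ℝ³` to a map of `ℝ³` by the
threshold (Kuhn–Freudenthal) interpolant `F p = ∫₀¹ X (kuhnLabel ⌈kuhnInv p − t·(1,1,1)⌉) dt`.  This module is its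
vocabulary: integer Kuhn coordinates `kuhnCoord (k,i,j) = (k, i+j+[k odd], j)` (inverse `kuhnLabel`), in which the ideal
hcp `hcpSite 1 √(2/3)` is the image of `ℤ³` under a piecewise-affine zigzag shear with slab parametrisations `slabMap k`
(linear part `slabLin s`, `s = ±1`), its explicit inverse `kuhnInv : ℝ³ → ℝ³`, and the algebra the interpolation needs:
`kuhnInv (Pᵢ u) = kuhnCoord u`, `slabMap k ∘ kuhnInv = id` on the closed slab `k`, `slabMap k v = Pᵢ (kuhnLabel v)` at the
integer points of the slab, and the slab Gram inequality `‖slabLin s d‖² ≥ ‖d‖₂²/2` (so `kuhnInv` is `√2`-Lipschitz from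
the Euclidean to the sup norm inside a slab, and `Σ|d_j| ≤ √6 ‖slabLin s d‖`).  Anchor (registered): `two_c2_sqrt6_le`.

All `[folklore]`.
-/

noncomputable section

namespace Summit.AtomisticToContinuum.Crystallization.Theorems.PalmUnimodularRigidity.LayeredLawsSelectHcp

open MeasureTheory Set
open Literature.MathematicalPhysics.StatisticalMechanics Literature.Geometry.DiscreteGeometry
open Summit.AtomisticToContinuum.Crystallization.Theorems.LayeredLawsSelectHcp.Negative.DiracLaws (GoodShell)

namespace KuhnChart

/-! ## Kuhn label coordinates of the ideal hcp -/

/-- The hcp label with Kuhn coordinates `v = (x₁, x₂, x₃)`: `(k, i, j) = (x₁, x₂ − x₃ − x₁ mod 2, x₃)`. [folklore] -/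
def kuhnLabel (v : ℤ × ℤ × ℤ) : ℤ × ℤ × ℤ := (v.1, v.2.1 - v.2.2 - v.1 % 2, v.2.2)

/-- The Kuhn coordinates of the hcp label `(k, i, j)`: `(k, i + j + k mod 2, j)`. [folklore] -/
def kuhnCoord (u : ℤ × ℤ × ℤ) : ℤ × ℤ × ℤ := (u.1, u.2.1 + u.2.2 + u.1 % 2, u.2.2)

/-- `kuhnLabel ∘ kuhnCoord = id`. [folklore] -/
theorem kuhnLabel_kuhnCoord (u : ℤ × ℤ × ℤ) : kuhnLabel (kuhnCoord u) = u := by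
  obtain ⟨k, i, j⟩ := u
  refine Prod.ext rfl (Prod.ext ?_ rfl)
  show i + j + k % 2 - j - k % 2 = i
  ring

/-- The `2`-periodic tent function with `ζ k = k mod 2` at integers (the letter of layer `k` of hcp, interpolated). [folklore] -/
def zigzag (s : ℝ) : ℝ := 1 - |1 - 2 * Int.fract (s / 2)|

/-- On the slab `k ≤ s ≤ k + 1` the tent is affine: `ζ s = k mod 2 + (1 − 2 (k mod 2)) (s − k)`. [folklore] -/
theorem zigzag_slab {k : ℤ} {s : ℝ} (h1 : (k : ℝ) ≤ s) (h2 : s ≤ k + 1) :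
    zigzag s = (k % 2 : ℤ) + (1 - 2 * ((k % 2 : ℤ) : ℝ)) * (s - k) := by
  unfold zigzag
  rcases Int.emod_two_eq_zero_or_one k with hk | hk
  · -- `k = 2n`
    obtain ⟨n, hn⟩ : ∃ n : ℤ, k = 2 * n := ⟨k / 2, by omega⟩
    rw [hk]
    have hkn : (k : ℝ) = 2 * n := by exact_mod_cast hn
    have hfl : ⌊s / 2⌋ = n ∨ s = k + 1 := by
      by_cases hs : s < k + 1
      · left
        rw [Int.floor_eq_iff]
        constructor
        · rw [hkn] at h1; linarith
        · rw [hkn] at hs; linarith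
      · right; linarith
    rcases hfl with hfl | hfl
    · rw [← Int.self_sub_floor, hfl]
      have : 1 - 2 * (s / 2 - (n : ℝ)) = 1 - (s - k) := by rw [hkn]; ring
      rw [this, abs_of_nonneg (by linarith)]
      push_cast; ring
    · subst hfl
      have hf : Int.fract (((k : ℝ) + 1) / 2) = 1 / 2 := by
        rw [Int.fract_eq_iff]
        refine ⟨by norm_num, by norm_num, n, ?_⟩
        rw [hkn]; ring
      rw [hf]; push_cast; norm_num
  · -- `k = 2n + 1`
    obtain ⟨n, hn⟩ : ∃ n : ℤ, k = 2 * n + 1 := ⟨k / 2, by omega⟩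
    rw [hk]
    have hkn : (k : ℝ) = 2 * n + 1 := by exact_mod_cast hn
    by_cases hs : s < k + 1
    · have hfl : ⌊s / 2⌋ = n := by
        rw [Int.floor_eq_iff]
        constructor
        · rw [hkn] at h1; linarith
        · rw [hkn] at hs; linarith
      rw [← Int.self_sub_floor, hfl]
      have : 1 - 2 * (s / 2 - (n : ℝ)) = -(s - k) := by rw [hkn]; ring
      rw [this, abs_of_nonpos (by linarith)]
      push_cast; ring
    · have hs' : s = k + 1 := le_antisymm h2 (not_lt.1 hs)
      subst hs'
      have hf : Int.fract (((k : ℝ) + 1) / 2) = 0 := by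
        rw [Int.fract_eq_iff]
        refine ⟨le_rfl, by norm_num, n + 1, ?_⟩
        rw [hkn]; push_cast; ring
      rw [hf]; push_cast; norm_num

/-- At integers the tent is the parity: `ζ k = k mod 2`. [folklore] -/
theorem zigzag_int (k : ℤ) : zigzag k = ((k % 2 : ℤ) : ℝ) := by
  rw [zigzag_slab (le_refl (k : ℝ)) (by linarith)]
  ring

/-- The layer spacing `√(2/3)` is positive. [folklore] -/
theorem sqrt_twoThirds_pos : 0 < Real.sqrt (2 / 3) := Real.sqrt_pos.2 (by norm_num)

/-- **The inverse zigzag shear** `Φ : ℝ³ → ℝ³`, physical point ↦ real Kuhn coordinates: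
`x₁ = p₃/h`, `x₂ = p₁ + p₂/√3 + ζ(x₁)/3`, `x₃ = 2 p₂/√3 − ζ(x₁)/3` (`h = √(2/3)`). [folklore] -/
def kuhnInv (p : EuclideanSpace ℝ (Fin 3)) : ℝ × ℝ × ℝ :=
  (p 2 / Real.sqrt (2 / 3),
    p 0 + p 1 / Real.sqrt 3 + zigzag (p 2 / Real.sqrt (2 / 3)) / 3,
    2 * p 1 / Real.sqrt 3 - zigzag (p 2 / Real.sqrt (2 / 3)) / 3)

/-- **The slab parametrisation** `Ψ_k : ℝ³ → ℝ³` (affine; the zigzag shear restricted to the slab `k ≤ x₁ ≤ k + 1` and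
extended affinely): `x ↦ x₂ g₁ + x₃ g₂ + (k mod 2 + s_k (x₁ − k)) ω + x₁ h e₃`, `g₁ = (1,0,0)`, `g₂ = (−1/2, √3/2, 0)`,
`ω = (−1/2, √3/6, 0)`, `s_k = 1 − 2 (k mod 2)`. [folklore] -/
def slabMap (k : ℤ) (x : ℝ × ℝ × ℝ) : EuclideanSpace ℝ (Fin 3) :=
  !₂[x.2.1 - x.2.2 / 2 - (((k % 2 : ℤ) : ℝ) + (1 - 2 * ((k % 2 : ℤ) : ℝ)) * (x.1 - k)) / 2,
    Real.sqrt 3 / 2 * x.2.2 + Real.sqrt 3 / 6 * (((k % 2 : ℤ) : ℝ) + (1 - 2 * ((k % 2 : ℤ) : ℝ)) * (x.1 - k)),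
    Real.sqrt (2 / 3) * x.1]

/-- **The linear part** `L_s` of the slab parametrisation with sign `s = ±1`. [folklore] -/
def slabLin (s : ℝ) : ℝ × ℝ × ℝ →ₗ[ℝ] EuclideanSpace ℝ (Fin 3) where
  toFun d := !₂[d.2.1 - d.2.2 / 2 - s * d.1 / 2, Real.sqrt 3 / 2 * d.2.2 + Real.sqrt 3 / 6 * (s * d.1),
    Real.sqrt (2 / 3) * d.1]
  map_add' x y := by
    ext l; fin_cases l <;> simp <;> ring
  map_smul' c x := by
    ext l; fin_cases l <;> simp <;> ring

/-- Coordinates of `slabLin`. [folklore] -/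
theorem slabLin_apply (s : ℝ) (d : ℝ × ℝ × ℝ) :
    slabLin s d 0 = d.2.1 - d.2.2 / 2 - s * d.1 / 2 ∧
      slabLin s d 1 = Real.sqrt 3 / 2 * d.2.2 + Real.sqrt 3 / 6 * (s * d.1) ∧
      slabLin s d 2 = Real.sqrt (2 / 3) * d.1 := by
  simp [slabLin]

/-- Coordinates of `slabMap`. [folklore] -/
theorem slabMap_apply (k : ℤ) (x : ℝ × ℝ × ℝ) :
    slabMap k x 0 = x.2.1 - x.2.2 / 2 - (((k % 2 : ℤ) : ℝ) + (1 - 2 * ((k % 2 : ℤ) : ℝ)) * (x.1 - k)) / 2 ∧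
      slabMap k x 1 = Real.sqrt 3 / 2 * x.2.2 +
        Real.sqrt 3 / 6 * (((k % 2 : ℤ) : ℝ) + (1 - 2 * ((k % 2 : ℤ) : ℝ)) * (x.1 - k)) ∧
      slabMap k x 2 = Real.sqrt (2 / 3) * x.1 := by
  simp [slabMap]

/-- **Differences of the slab parametrisation are the linear part**: `Ψ_k x − Ψ_k y = L_{s_k} (x − y)`. [folklore] -/
theorem slabMap_sub (k : ℤ) (x y : ℝ × ℝ × ℝ) :
    slabMap k x - slabMap k y = slabLin (1 - 2 * ((k % 2 : ℤ) : ℝ)) (x - y) := by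
  obtain ⟨a0, a1, a2⟩ := slabMap_apply k x
  obtain ⟨b0, b1, b2⟩ := slabMap_apply k y
  obtain ⟨c0, c1, c2⟩ := slabLin_apply (1 - 2 * ((k % 2 : ℤ) : ℝ)) (x - y)
  ext l
  fin_cases l
  · simp only [Fin.zero_eta, PiLp.sub_apply, a0, b0, c0, Prod.fst_sub, Prod.snd_sub]; ring
  · simp only [Fin.mk_one, PiLp.sub_apply, a1, b1, c1, Prod.fst_sub, Prod.snd_sub]; ring
  · simp only [Fin.reduceFinMk, PiLp.sub_apply, a2, b2, c2, Prod.fst_sub]; ring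

/-- **The slab Gram inequality**: `‖L_s d‖² = ‖d‖₂²/2 + (d₁ − s d₂ + s d₃)²/2 ≥ ‖d‖₂²/2` for `s = ±1`, in the form
`d₁² + d₂² + d₃² ≤ 2 ‖L_s d‖²`. [folklore] -/
theorem sq_le_two_mul_norm_slabLin_sq {s : ℝ} (hs : s = 1 ∨ s = -1) (d : ℝ × ℝ × ℝ) :
    d.1 ^ 2 + d.2.1 ^ 2 + d.2.2 ^ 2 ≤ 2 * ‖slabLin s d‖ ^ 2 := by
  obtain ⟨c0, c1, c2⟩ := slabLin_apply s d
  have hn : ‖slabLin s d‖ ^ 2 = (slabLin s d 0) ^ 2 + (slabLin s d 1) ^ 2 + (slabLin s d 2) ^ 2 := by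
    rw [EuclideanSpace.norm_eq, Real.sq_sqrt (Finset.sum_nonneg fun _ _ => sq_nonneg _), Fin.sum_univ_three]
    simp only [Real.norm_eq_abs, sq_abs]
  rw [hn, c0, c1, c2]
  have h3 : Real.sqrt 3 ^ 2 = 3 := Real.sq_sqrt (by norm_num)
  have h23 : Real.sqrt (2 / 3) ^ 2 = 2 / 3 := Real.sq_sqrt (by norm_num)
  have key : (d.2.1 - d.2.2 / 2 - s * d.1 / 2) ^ 2 + (Real.sqrt 3 / 2 * d.2.2 + Real.sqrt 3 / 6 * (s * d.1)) ^ 2 +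
      (Real.sqrt (2 / 3) * d.1) ^ 2 =
      (d.1 ^ 2 + d.2.1 ^ 2 + d.2.2 ^ 2) / 2 + (d.1 - s * d.2.1 + s * d.2.2) ^ 2 / 2 := by
    have hs2 : s ^ 2 = 1 := by rcases hs with rfl | rfl <;> norm_num
    have e1 : (Real.sqrt 3 / 2 * d.2.2 + Real.sqrt 3 / 6 * (s * d.1)) ^ 2 =
        Real.sqrt 3 ^ 2 * (d.2.2 / 2 + s * d.1 / 6) ^ 2 := by ring
    have e2 : (Real.sqrt (2 / 3) * d.1) ^ 2 = Real.sqrt (2 / 3) ^ 2 * d.1 ^ 2 := by ring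
    rw [e1, e2, h3, h23]
    linear_combination (d.1 ^ 2 / 3 - (d.2.1 - d.2.2) ^ 2 / 2) * hs2
  rw [key]
  nlinarith [sq_nonneg (d.1 - s * d.2.1 + s * d.2.2)]

/-- **Metric consequence**: `|d₁| + |d₂| + |d₃| ≤ √6 ‖L_s d‖` and each `|d_j| ≤ √2 ‖L_s d‖`. [folklore] -/
theorem abs_le_of_slabLin {s : ℝ} (hs : s = 1 ∨ s = -1) (d : ℝ × ℝ × ℝ) :
    |d.1| + |d.2.1| + |d.2.2| ≤ Real.sqrt 6 * ‖slabLin s d‖ ∧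
      |d.1| ≤ Real.sqrt 2 * ‖slabLin s d‖ ∧ |d.2.1| ≤ Real.sqrt 2 * ‖slabLin s d‖ ∧
      |d.2.2| ≤ Real.sqrt 2 * ‖slabLin s d‖ := by
  have h := sq_le_two_mul_norm_slabLin_sq hs d
  have hN : 0 ≤ ‖slabLin s d‖ := norm_nonneg _
  have h6 : Real.sqrt 6 ^ 2 = 6 := Real.sq_sqrt (by norm_num)
  have h2 : Real.sqrt 2 ^ 2 = 2 := Real.sq_sqrt (by norm_num)
  have h6p : 0 ≤ Real.sqrt 6 := Real.sqrt_nonneg _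
  have h2p : 0 ≤ Real.sqrt 2 := Real.sqrt_nonneg _
  have a1 := abs_nonneg d.1
  have a2 := abs_nonneg d.2.1
  have a3 := abs_nonneg d.2.2
  have s1 : |d.1| ^ 2 = d.1 ^ 2 := sq_abs _
  have s2 : |d.2.1| ^ 2 = d.2.1 ^ 2 := sq_abs _
  have s3 : |d.2.2| ^ 2 = d.2.2 ^ 2 := sq_abs _
  refine ⟨?_, ?_, ?_, ?_⟩
  · -- `(Σ|d_j|)² ≤ 3 Σ d_j² ≤ 6 ‖L d‖²`
    have hsq : (|d.1| + |d.2.1| + |d.2.2|) ^ 2 ≤ (Real.sqrt 6 * ‖slabLin s d‖) ^ 2 := by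
      rw [mul_pow, h6]
      nlinarith [sq_nonneg (|d.1| - |d.2.1|), sq_nonneg (|d.1| - |d.2.2|), sq_nonneg (|d.2.1| - |d.2.2|)]
    exact (pow_le_pow_iff_left₀ (by positivity) (by positivity) two_ne_zero).1 hsq
  · have hsq : |d.1| ^ 2 ≤ (Real.sqrt 2 * ‖slabLin s d‖) ^ 2 := by
      rw [mul_pow, h2, s1]; nlinarith [sq_nonneg d.2.1, sq_nonneg d.2.2]
    exact (pow_le_pow_iff_left₀ (by positivity) (by positivity) two_ne_zero).1 hsq
  · have hsq : |d.2.1| ^ 2 ≤ (Real.sqrt 2 * ‖slabLin s d‖) ^ 2 := by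
      rw [mul_pow, h2, s2]; nlinarith [sq_nonneg d.1, sq_nonneg d.2.2]
    exact (pow_le_pow_iff_left₀ (by positivity) (by positivity) two_ne_zero).1 hsq
  · have hsq : |d.2.2| ^ 2 ≤ (Real.sqrt 2 * ‖slabLin s d‖) ^ 2 := by
      rw [mul_pow, h2, s3]; nlinarith [sq_nonneg d.1, sq_nonneg d.2.1]
    exact (pow_le_pow_iff_left₀ (by positivity) (by positivity) two_ne_zero).1 hsq

/-! ## The shear inverts the slab parametrisations and reads the Kuhn coordinates of the sites -/

/-- **`Φ` reads the Kuhn coordinates of the ideal sites**: `Φ (Pᵢ u) = kuhnCoord u`. [folklore] -/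
theorem kuhnInv_hcpSite (u : ℤ × ℤ × ℤ) :
    kuhnInv (hcpSite 1 (Real.sqrt (2 / 3)) u) =
      (((kuhnCoord u).1 : ℝ), ((kuhnCoord u).2.1 : ℝ), ((kuhnCoord u).2.2 : ℝ)) := by
  have hh : Real.sqrt (2 / 3) ≠ 0 := sqrt_twoThirds_pos.ne'
  have h3 : Real.sqrt 3 ≠ 0 := (Real.sqrt_pos.2 (by norm_num : (0 : ℝ) < 3)).ne'
  have e0 := hcpSite_apply_zero 1 (Real.sqrt (2 / 3)) u
  have e1 := hcpSite_apply_one 1 (Real.sqrt (2 / 3)) u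
  have e2 := hcpSite_apply_two 1 (Real.sqrt (2 / 3)) u
  rw [haggLabel_alternating_eq_emod] at e0 e1
  have hx1 : hcpSite 1 (Real.sqrt (2 / 3)) u 2 / Real.sqrt (2 / 3) = u.1 := by
    rw [e2]; field_simp
  simp only [kuhnInv, kuhnCoord, hx1, zigzag_int, e0, e1]
  refine Prod.ext rfl (Prod.ext ?_ ?_)
  · show (1 : ℝ) * (u.2.1 + u.2.2 / 2 + ((u.1 % 2 : ℤ) : ℝ) / 2) +
        1 * Real.sqrt 3 / 2 * (u.2.2 + ((u.1 % 2 : ℤ) : ℝ) / 3) / Real.sqrt 3 + ((u.1 % 2 : ℤ) : ℝ) / 3 =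
        ((u.2.1 + u.2.2 + u.1 % 2 : ℤ) : ℝ)
    push_cast
    field_simp
    ring
  · show 2 * (1 * Real.sqrt 3 / 2 * (u.2.2 + ((u.1 % 2 : ℤ) : ℝ) / 3)) / Real.sqrt 3 - ((u.1 % 2 : ℤ) : ℝ) / 3 =
        (u.2.2 : ℝ)
    field_simp
    ring

/-- The first Kuhn coordinate is the height in layer units. [folklore] -/
theorem kuhnInv_fst (p : EuclideanSpace ℝ (Fin 3)) : (kuhnInv p).1 = p 2 / Real.sqrt (2 / 3) := rfl

/-- **`Ψ_k ∘ Φ = id` on the closed slab `k`**. [folklore] -/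
theorem slabMap_kuhnInv {k : ℤ} {p : EuclideanSpace ℝ (Fin 3)} (h1 : (k : ℝ) ≤ p 2 / Real.sqrt (2 / 3))
    (h2 : p 2 / Real.sqrt (2 / 3) ≤ k + 1) : slabMap k (kuhnInv p) = p := by
  have hh : Real.sqrt (2 / 3) ≠ 0 := sqrt_twoThirds_pos.ne'
  have h3 : Real.sqrt 3 ≠ 0 := (Real.sqrt_pos.2 (by norm_num : (0 : ℝ) < 3)).ne'
  have h33 : Real.sqrt 3 * Real.sqrt 3 = 3 := by rw [← pow_two]; exact Real.sq_sqrt (by norm_num)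
  have hz := zigzag_slab h1 h2
  obtain ⟨a0, a1, a2⟩ := slabMap_apply k (kuhnInv p)
  ext l
  fin_cases l
  · rw [show ((⟨0, by norm_num⟩ : Fin 3)) = 0 from rfl, a0]
    simp only [kuhnInv, ← hz]
    field_simp
    ring
  · rw [show ((⟨1, by norm_num⟩ : Fin 3)) = 1 from rfl, a1]
    simp only [kuhnInv, ← hz]
    field_simp
    nlinarith [h33]
  · rw [show ((⟨2, by norm_num⟩ : Fin 3)) = 2 from rfl, a2]
    simp only [kuhnInv]
    field_simp

/-- **The slab parametrisation at the integer points of the slab gives the ideal sites**: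
`Ψ_k v = Pᵢ (kuhnLabel v)` for `v₁ ∈ {k, k+1}`. [folklore] -/
theorem slabMap_intCast {k : ℤ} (v : ℤ × ℤ × ℤ) (hv : v.1 = k ∨ v.1 = k + 1) :
    slabMap k ((v.1 : ℝ), (v.2.1 : ℝ), (v.2.2 : ℝ)) = hcpSite 1 (Real.sqrt (2 / 3)) (kuhnLabel v) := by
  have e0 := hcpSite_apply_zero 1 (Real.sqrt (2 / 3)) (kuhnLabel v)
  have e1 := hcpSite_apply_one 1 (Real.sqrt (2 / 3)) (kuhnLabel v)
  have e2 := hcpSite_apply_two 1 (Real.sqrt (2 / 3)) (kuhnLabel v)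
  rw [haggLabel_alternating_eq_emod] at e0 e1
  -- the interpolated letter at `v₁` is the parity of `v₁`
  have hpar : ((k % 2 : ℤ) : ℝ) + (1 - 2 * ((k % 2 : ℤ) : ℝ)) * ((v.1 : ℝ) - k) = ((v.1 % 2 : ℤ) : ℝ) := by
    rcases hv with hv | hv
    · rw [hv]; ring
    · have : v.1 % 2 = 1 - k % 2 := by rw [hv]; omega
      rw [this, hv]; push_cast; ring
  obtain ⟨a0, a1, a2⟩ := slabMap_apply k ((v.1 : ℝ), (v.2.1 : ℝ), (v.2.2 : ℝ))
  have hl1 : ((kuhnLabel v).1 : ℝ) = v.1 := rfl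
  have hl2 : ((kuhnLabel v).2.1 : ℝ) = v.2.1 - v.2.2 - ((v.1 % 2 : ℤ) : ℝ) := by
    simp only [kuhnLabel]; push_cast; ring
  have hl3 : ((kuhnLabel v).2.2 : ℝ) = v.2.2 := rfl
  have hl4 : (kuhnLabel v).1 = v.1 := rfl
  ext l
  fin_cases l
  · rw [show ((⟨0, by norm_num⟩ : Fin 3)) = 0 from rfl, a0, e0, hl2, hl3, hl4]
    simp only [hpar]
    ring
  · rw [show ((⟨1, by norm_num⟩ : Fin 3)) = 1 from rfl, a1, e1, hl3, hl4]
    simp only [hpar]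
    ring
  · rw [show ((⟨2, by norm_num⟩ : Fin 3)) = 2 from rfl, a2, e2, hl1]
    ring

/-- **Physical differences inside one closed slab are the linear part applied to Kuhn differences**:
`p − q = L_{s_k} (Φ p − Φ q)`. [folklore] -/
theorem sub_eq_slabLin {k : ℤ} {p q : EuclideanSpace ℝ (Fin 3)} (hp1 : (k : ℝ) ≤ p 2 / Real.sqrt (2 / 3))
    (hp2 : p 2 / Real.sqrt (2 / 3) ≤ k + 1) (hq1 : (k : ℝ) ≤ q 2 / Real.sqrt (2 / 3))
    (hq2 : q 2 / Real.sqrt (2 / 3) ≤ k + 1) :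
    p - q = slabLin (1 - 2 * ((k % 2 : ℤ) : ℝ)) (kuhnInv p - kuhnInv q) := by
  rw [← slabMap_sub, slabMap_kuhnInv hp1 hp2, slabMap_kuhnInv hq1 hq2]

/-- The slab sign is `±1`. [folklore] -/
theorem slabSign_cases (k : ℤ) : (1 - 2 * ((k % 2 : ℤ) : ℝ)) = 1 ∨ (1 - 2 * ((k % 2 : ℤ) : ℝ)) = -1 := by
  rcases Int.emod_two_eq_zero_or_one k with h | h
  · left; rw [h]; norm_num
  · right; rw [h]; norm_num

/-- **`Φ` is `√2`-Lipschitz (Euclidean → sup) inside one closed slab.** [folklore] -/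
theorem norm_kuhnInv_sub_le_slab {k : ℤ} {p q : EuclideanSpace ℝ (Fin 3)} (hp1 : (k : ℝ) ≤ p 2 / Real.sqrt (2 / 3))
    (hp2 : p 2 / Real.sqrt (2 / 3) ≤ k + 1) (hq1 : (k : ℝ) ≤ q 2 / Real.sqrt (2 / 3))
    (hq2 : q 2 / Real.sqrt (2 / 3) ≤ k + 1) : ‖kuhnInv p - kuhnInv q‖ ≤ Real.sqrt 2 * ‖p - q‖ := by
  obtain ⟨-, h1, h2, h3⟩ := abs_le_of_slabLin (slabSign_cases k) (kuhnInv p - kuhnInv q)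
  rw [← sub_eq_slabLin hp1 hp2 hq1 hq2] at h1 h2 h3
  rw [Prod.norm_def, Prod.norm_def, Real.norm_eq_abs, Real.norm_eq_abs, Real.norm_eq_abs]
  exact max_le h1 (max_le h2 h3)

end KuhnChart

/-- **Anchor (registered sub-goal of stmt-AtomisticToContinuum-9226)**: the numerical margin of the threshold interpolation,
`2 c₂ √6 ≤ 3/8` with `c₂ = 758/10000` (`√6 ≤ 49/20`). [folklore] -/
theorem two_c2_sqrt6_le : 2 * (758 / 10000 : ℝ) * Real.sqrt 6 ≤ 3 / 8 := by
  have h6 : Real.sqrt 6 ≤ 49 / 20 := by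
    rw [show (49 / 20 : ℝ) = Real.sqrt ((49 / 20) ^ 2) by rw [Real.sqrt_sq (by norm_num)]]
    exact Real.sqrt_le_sqrt (by norm_num)
  nlinarith [Real.sqrt_nonneg 6]

end Summit.AtomisticToContinuum.Crystallization.Theorems.PalmUnimodularRigidity.LayeredLawsSelectHcp

end
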